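import Mathlib
import Summits.AtomisticToContinuum.Crystallization.Theorems.ChessboardParticlePlanesLjLaminarWindowsGlueC5
import HarnessLib

/-! # Spiky scales are comparable (from the coin structure) — stub `stub_coinScaleRatio` of line `Sketch` (skeleton rev. 10, lead c6), crux `LjLaminarWindows` (stmt-AtomisticToContinuum-6711) -/

noncomputable section

open scoped BigOperators
open Filter Topology
open Literature.MathematicalPhysics.StatisticalMechanics
open Summit.AtomisticToContinuum.Crystallization.Theorems.ChargedEnergyGapNegative

namespace Summit.AtomisticToContinuum.Crystallization.Theorems.LjLaminarWindowsSketch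

/-- A finite set of `7/10`-separated particles inside a slab-disc of thickness `R` and radius
`C √(L R)` (`R, C, L ≥ 1`) has at most `216 C² L R²` members: the slab packing bound at
`ρ = C √(L R)`, `ρ² = C² L R`. [folklore] -/
theorem coinScaleRatio_class_card_le
    (hSlab : ∀ (N : ℕ) (x : Fin N → E3), (∀ j k : Fin N, j ≠ k → (7 : ℝ) / 10 ≤ dist (x j) (x k)) →
      ∀ (R ρ : ℝ), 1 ≤ R → 1 ≤ ρ → ∀ (z : E3) (A : E3 →ₗᵢ[ℝ] E3) (S : Finset (Fin N)),
        (∀ p ∈ S, |(A (x p - z)) 2| ≤ R ∧ dist (x p) z ≤ ρ) →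
        (S.card : ℝ) ≤ 216 * ρ ^ 2 * R)
    {N : ℕ} (x : Fin N → E3) (hsep : ∀ j k : Fin N, j ≠ k → (7 : ℝ) / 10 ≤ dist (x j) (x k))
    {R C L : ℝ} (hR : 1 ≤ R) (hC : 1 ≤ C) (hL : 1 ≤ L) (z : E3) (A : E3 →ₗᵢ[ℝ] E3)
    (S : Finset (Fin N))
    (hS : ∀ p ∈ S, |(A (x p - z)) 2| ≤ R ∧ dist (x p) z ≤ C * Real.sqrt (L * R)) :
    (S.card : ℝ) ≤ 216 * C ^ 2 * L * R ^ 2 := by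
  have hρ : 1 ≤ C * Real.sqrt (L * R) :=
    one_le_mul_of_one_le_of_one_le hC (Real.one_le_sqrt.2 (by nlinarith))
  have hs : Real.sqrt (L * R) ^ 2 = L * R := Real.sq_sqrt (by positivity)
  calc (S.card : ℝ) ≤ 216 * (C * Real.sqrt (L * R)) ^ 2 * R :=
      hSlab N x hsep R (C * Real.sqrt (L * R)) hR hρ z A S hS
    _ = 216 * C ^ 2 * L * R ^ 2 := by rw [mul_pow, hs]; ring

/-- The label classes partition the particles: `∑_{l ∈ lab(univ)} #{p : lab p = l} = N`.
[folklore] -/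
theorem coinScaleRatio_sum_card_classes {N : ℕ} (lab : Fin N → ℕ) :
    ∑ l ∈ Finset.univ.image lab, ((Finset.univ.filter fun p : Fin N => lab p = l).card : ℝ) = N := by
  rw [← Nat.cast_sum, ← Finset.card_eq_sum_card_image lab Finset.univ, Finset.card_univ,
    Fintype.card_fin]

/-- The equally-labelled ordered pairs are counted class by class:
`#{(p,q) : lab p = lab q} = ∑_{l ∈ lab(univ)} #{p : lab p = l}²`. [folklore] -/
theorem coinScaleRatio_card_samelabel_eq {N : ℕ} (lab : Fin N → ℕ) :
    ((Finset.univ.filter fun p : Fin N × Fin N => lab p.1 = lab p.2).card : ℝ) =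
      ∑ l ∈ Finset.univ.image lab,
        ((Finset.univ.filter fun p : Fin N => lab p = l).card : ℝ) ^ 2 := by
  classical
  rw [Finset.card_eq_sum_card_fiberwise (f := fun p : Fin N × Fin N => lab p.1)
    (s := Finset.univ.filter fun p : Fin N × Fin N => lab p.1 = lab p.2)
    (t := Finset.univ.image lab)
    (fun p _ => Finset.mem_coe.2 (Finset.mem_image_of_mem lab (Finset.mem_univ p.1))),
    Nat.cast_sum]
  refine Finset.sum_congr rfl fun l _ => ?_
  have e : ((Finset.univ.filter fun p : Fin N × Fin N => lab p.1 = lab p.2).filter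
      fun p : Fin N × Fin N => lab p.1 = l) =
      (Finset.univ.filter fun p : Fin N => lab p = l) ×ˢ
        (Finset.univ.filter fun p : Fin N => lab p = l) := by
    ext p
    simp only [Finset.mem_filter, Finset.mem_product, Finset.mem_univ, true_and]
    constructor
    · rintro ⟨h1, h2⟩
      exact ⟨h2, h1.symm.trans h2⟩
    · rintro ⟨h1, h2⟩
      exact ⟨h1.trans h2.symm, h1⟩
  rw [e, Finset.card_product, Nat.cast_mul, sq]

/-- If every label class has at most `B` members, the number of equally-labelled ordered pairs is
at most `N B`. [folklore] -/
theorem coinScaleRatio_samelabel_le {N : ℕ} (lab : Fin N → ℕ) {B : ℝ}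
    (hB : ∀ l : ℕ, ((Finset.univ.filter fun p : Fin N => lab p = l).card : ℝ) ≤ B) :
    ((Finset.univ.filter fun p : Fin N × Fin N => lab p.1 = lab p.2).card : ℝ) ≤ N * B := by
  rw [coinScaleRatio_card_samelabel_eq lab, ← coinScaleRatio_sum_card_classes lab, Finset.sum_mul]
  refine Finset.sum_le_sum fun l _ => ?_
  rw [sq]
  exact mul_le_mul_of_nonneg_left (hB l) (Nat.cast_nonneg _)

/-- Equally-labelled close pairs, class by class, are close pairs: for any finite set `H` of
labels, `∑_{l ∈ H} #{(p,q) ∈ S_l × S_l : dist ≤ L} ≤ F(L)` (the class-pair sets are pairwise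
disjoint). [folklore] -/
theorem coinScaleRatio_sum_card_classpairs_le {N : ℕ} (x : Fin N → E3) (lab : Fin N → ℕ)
    (H : Finset ℕ) (L : ℝ) :
    ∑ l ∈ H, ((((Finset.univ.filter fun p : Fin N => lab p = l) ×ˢ
        (Finset.univ.filter fun p : Fin N => lab p = l)).filter
          fun p : Fin N × Fin N => dist (x p.1) (x p.2) ≤ L).card : ℝ) ≤
      ((Finset.univ.filter fun p : Fin N × Fin N => dist (x p.1) (x p.2) ≤ L).card : ℝ) := by
  classical
  have hdisj : (H : Set ℕ).PairwiseDisjoint fun l =>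
      ((Finset.univ.filter fun p : Fin N => lab p = l) ×ˢ
        (Finset.univ.filter fun p : Fin N => lab p = l)).filter
          fun p : Fin N × Fin N => dist (x p.1) (x p.2) ≤ L := by
    intro l _ l' _ hne
    refine Finset.disjoint_left.2 fun p hp hp' => ?_
    simp only [Finset.mem_filter, Finset.mem_product, Finset.mem_univ, true_and] at hp hp'
    exact hne (hp.1.1.symm.trans hp'.1.1)
  have hsub : (H.biUnion fun l =>
      ((Finset.univ.filter fun p : Fin N => lab p = l) ×ˢ
        (Finset.univ.filter fun p : Fin N => lab p = l)).filter
          fun p : Fin N × Fin N => dist (x p.1) (x p.2) ≤ L) ⊆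
      Finset.univ.filter fun p : Fin N × Fin N => dist (x p.1) (x p.2) ≤ L := by
    intro p hp
    obtain ⟨l, -, hp⟩ := Finset.mem_biUnion.1 hp
    exact Finset.mem_filter.2 ⟨Finset.mem_univ _, (Finset.mem_filter.1 hp).2⟩
  have h := Finset.card_le_card hsub
  rw [Finset.card_biUnion hdisj] at h
  exact_mod_cast h

/-- If two particles are more than `D` apart, every particle has some particle more than `D/2`
away (triangle inequality). [folklore] -/
theorem coinScaleRatio_exists_far {N : ℕ} (x : Fin N → E3) {D : ℝ} {p₀ q₀ : Fin N}
    (h : D < dist (x p₀) (x q₀)) (i : Fin N) : ∃ j : Fin N, D / 2 < dist (x j) (x i) := by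
  by_contra hcon
  push Not at hcon
  have h3 := dist_triangle (x p₀) (x i) (x q₀)
  rw [dist_comm (x i) (x q₀)] at h3
  linarith [hcon p₀, hcon q₀]

/-- **Pair count from the path count.** In a `23/20`-connected configuration containing two
particles more than `L' - R` apart (`0 ≤ R`, `2R ≤ L'`), every particle has at least
`(10/23)(L' - R) ≥ (5/23) L'` particles within `L'`; summing over the particles,
`F(L') ≥ (5/23) L' N`. [folklore] -/
theorem coinScaleRatio_pairs_lower
    (hPC : ∀ (N : ℕ) (x : Fin N → E3) (ρ : ℝ), 0 < ρ →
      (∀ S : Finset (Fin N), S.Nonempty → Sᶜ.Nonempty → ∃ p ∈ S, ∃ k ∈ Sᶜ, dist (x p) (x k) ≤ ρ) →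
      ∀ (i : Fin N) (L : ℝ), 0 ≤ L → (∃ j : Fin N, L < dist (x j) (x i)) →
        L / ρ ≤ ((Finset.univ.filter fun j : Fin N => dist (x j) (x i) ≤ L).card : ℝ))
    {N : ℕ} (x : Fin N → E3)
    (hconn : ∀ S : Finset (Fin N), S.Nonempty → Sᶜ.Nonempty →
      ∃ p ∈ S, ∃ k ∈ Sᶜ, dist (x p) (x k) ≤ 23 / 20)
    {L' R : ℝ} (hR : 0 ≤ R) (hRL : 2 * R ≤ L') {p₀ q₀ : Fin N}
    (hd : L' - R < dist (x p₀) (x q₀)) :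
    5 / 23 * L' * N ≤
      ((Finset.univ.filter fun p : Fin N × Fin N => dist (x p.1) (x p.2) ≤ L').card : ℝ) := by
  classical
  have e := glueC5_sum_card_dist x (fun d => d ≤ L')
  refine le_trans ?_ e.le
  have key : ∀ i : Fin N, 5 / 23 * L' ≤
      ((Finset.univ.filter fun j : Fin N => dist (x j) (x i) ≤ L').card : ℝ) := by
    intro i
    obtain ⟨j, hj⟩ := coinScaleRatio_exists_far x hd i
    have h0 : 0 ≤ (L' - R) / 2 := by linarith
    have hpc := hPC N x (23 / 20) (by norm_num) hconn i ((L' - R) / 2) h0 ⟨j, hj⟩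
    have hsub : (Finset.univ.filter fun j : Fin N => dist (x j) (x i) ≤ (L' - R) / 2) ⊆
        (Finset.univ.filter fun j : Fin N => dist (x j) (x i) ≤ L') := by
      intro k hk
      simp only [Finset.mem_filter, Finset.mem_univ, true_and] at hk ⊢
      linarith
    have hmono : ((Finset.univ.filter fun j : Fin N => dist (x j) (x i) ≤ (L' - R) / 2).card : ℝ) ≤
        ((Finset.univ.filter fun j : Fin N => dist (x j) (x i) ≤ L').card : ℝ) := by
      exact_mod_cast Finset.card_le_card hsub
    have h5 : 5 / 23 * L' ≤ (L' - R) / 2 / (23 / 20) := by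
      rw [le_div_iff₀ (by norm_num : (0 : ℝ) < 23 / 20)]
      linarith
    linarith
  calc 5 / 23 * L' * N = ∑ _i : Fin N, 5 / 23 * L' := by
        rw [Finset.sum_const, Finset.card_univ, Fintype.card_fin, nsmul_eq_mul]; ring
    _ ≤ _ := Finset.sum_le_sum fun i _ => key i

/-- **Heavy classes.** Non-negative class sizes `n l ≤ B` with `∑ n = Ntot` and
`∑ n² > 2 a Ntot`: the light classes (`n l < a`) carry `∑ n² ≤ a Ntot`, so the heavy ones carry
`∑ n² > a Ntot`, hence `∑_{heavy} n > a Ntot / B`; if moreover `n l² ≤ m t l` on heavy classes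
(`t ≥ 0`), then `∑ t > a² Ntot / (m B)`. [folklore] -/
theorem coinScaleRatio_heavy_sum (T : Finset ℕ) (n t : ℕ → ℝ) {a B m Ntot : ℝ} (ha : 0 < a)
    (hB : 0 < B) (hm : 0 < m) (hn0 : ∀ l ∈ T, 0 ≤ n l) (ht0 : ∀ l ∈ T, 0 ≤ t l)
    (hsum : ∑ l ∈ T, n l = Ntot) (hQ : 2 * a * Ntot < ∑ l ∈ T, n l ^ 2)
    (hnB : ∀ l ∈ T, n l ≤ B) (hcov : ∀ l ∈ T, a ≤ n l → n l ^ 2 ≤ m * t l) :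
    a ^ 2 * Ntot / (m * B) < ∑ l ∈ T, t l := by
  classical
  have hlight : ∑ l ∈ T.filter (fun l => ¬ a ≤ n l), n l ^ 2 ≤ a * Ntot := by
    calc ∑ l ∈ T.filter (fun l => ¬ a ≤ n l), n l ^ 2
        ≤ ∑ l ∈ T.filter (fun l => ¬ a ≤ n l), a * n l := by
          refine Finset.sum_le_sum fun l hl => ?_
          have hl' := Finset.mem_filter.1 hl
          have hlt : n l < a := lt_of_not_ge hl'.2
          have h0 := hn0 l hl'.1
          nlinarith
      _ ≤ ∑ l ∈ T, a * n l :=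
          Finset.sum_le_sum_of_subset_of_nonneg (Finset.filter_subset _ _)
            fun l hl _ => mul_nonneg ha.le (hn0 l hl)
      _ = a * Ntot := by rw [← Finset.mul_sum, hsum]
  have hsplit : ∑ l ∈ T.filter (fun l => a ≤ n l), n l ^ 2 +
      ∑ l ∈ T.filter (fun l => ¬ a ≤ n l), n l ^ 2 = ∑ l ∈ T, n l ^ 2 :=
    Finset.sum_filter_add_sum_filter_not T (fun l => a ≤ n l) (fun l => n l ^ 2)
  have hheavy2 : a * Ntot < ∑ l ∈ T.filter (fun l => a ≤ n l), n l ^ 2 := by linarith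
  have hheavy1 : ∑ l ∈ T.filter (fun l => a ≤ n l), n l ^ 2 ≤
      B * ∑ l ∈ T.filter (fun l => a ≤ n l), n l := by
    rw [Finset.mul_sum]
    refine Finset.sum_le_sum fun l hl => ?_
    have hl' := (Finset.mem_filter.1 hl).1
    have h1 := hnB l hl'
    have h0 := hn0 l hl'
    nlinarith
  have hcovsum : a * ∑ l ∈ T.filter (fun l => a ≤ n l), n l ≤
      m * ∑ l ∈ T.filter (fun l => a ≤ n l), t l := by
    rw [Finset.mul_sum, Finset.mul_sum]
    refine Finset.sum_le_sum fun l hl => ?_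
    have hl' := Finset.mem_filter.1 hl
    have hc := hcov l hl'.1 hl'.2
    have h0 := hn0 l hl'.1
    nlinarith [hl'.2]
  have hHT : ∑ l ∈ T.filter (fun l => a ≤ n l), t l ≤ ∑ l ∈ T, t l :=
    Finset.sum_le_sum_of_subset_of_nonneg (Finset.filter_subset _ _) fun l hl _ => ht0 l hl
  rw [div_lt_iff₀ (mul_pos hm hB)]
  linarith [mul_lt_mul_of_pos_left hheavy2 ha, mul_le_mul_of_nonneg_left hheavy1 ha.le,
    mul_le_mul_of_nonneg_left hcovsum hB.le, mul_le_mul_of_nonneg_left hHT (mul_pos hm hB).le]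

/-- **The two régimes.** From `(a₀ L'/2)² < A₁ L · max(1, 64 C² L' R / L²) · (216 C² L' R²)`:
either the maximum is `1` and `L' ≤ (4 · 216 C² A₁ R² / a₀²) L`, or
`L < 256 · 216 A₁ C⁴ R³ / a₀²`, which the threshold excludes. [folklore] -/
theorem coinScaleRatio_final {a₀ A₁ C R L L' : ℝ} (ha₀ : 0 < a₀) (hR : 1 ≤ R) (hL : 0 < L)
    (hL' : 0 < L')
    (hstar : (a₀ * L' / 2) ^ 2 <
      A₁ * L * (max 1 (64 * (C * Real.sqrt (L' * R)) ^ 2 / L ^ 2) * (216 * C ^ 2 * L' * R ^ 2)))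
    (hLA : 256 * A₁ * C ^ 2 * (216 * C ^ 2) * R ^ 3 / a₀ ^ 2 + 1 ≤ L) :
    L' ≤ 4 * A₁ * (216 * C ^ 2) * R ^ 2 / a₀ ^ 2 * L := by
  have hρ : (C * Real.sqrt (L' * R)) ^ 2 = C ^ 2 * (L' * R) := by
    rw [mul_pow, Real.sq_sqrt (by positivity)]
  rw [hρ] at hstar
  have ha2 : 0 < a₀ ^ 2 := by positivity
  rcases le_total (64 * (C ^ 2 * (L' * R)) / L ^ 2) 1 with hle | hge
  · rw [max_eq_left hle, one_mul] at hstar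
    have h1 : L' * (a₀ ^ 2 * L') < L' * (4 * A₁ * (216 * C ^ 2) * R ^ 2 * L) := by linarith
    have h2 : a₀ ^ 2 * L' < 4 * A₁ * (216 * C ^ 2) * R ^ 2 * L := lt_of_mul_lt_mul_left h1 hL'.le
    rw [div_mul_eq_mul_div, le_div_iff₀ ha2]
    linarith
  · rw [max_eq_right hge] at hstar
    exfalso
    have hL2 : 0 < L ^ 2 := by positivity
    have h1 := mul_lt_mul_of_pos_right hstar hL2
    rw [div_mul_eq_mul_div, ← mul_div_assoc, div_mul_cancel₀ _ hL2.ne'] at h1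
    have h2 : L' ^ 2 * L * (a₀ ^ 2 * L) <
        L' ^ 2 * L * (256 * A₁ * C ^ 2 * (216 * C ^ 2) * R ^ 3) := by
      linarith
    have h3 : a₀ ^ 2 * L < 256 * A₁ * C ^ 2 * (216 * C ^ 2) * R ^ 3 :=
      lt_of_mul_lt_mul_left h2 (by positivity)
    have h4 : L < 256 * A₁ * C ^ 2 * (216 * C ^ 2) * R ^ 3 / a₀ ^ 2 := by
      rw [lt_div_iff₀ ha2]; linarith
    linarith

/-- **C6e — spiky scales are comparable** (provable now from C6a's conclusion, C6c, C6d and the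
landed path count): if the coin structure holds with junk fraction `κ/2`, then two `κ`-spiky scales
`L ≤ L'` beyond a threshold satisfy `L' ≤ C₆ L` — at scale `L` the flat coins give
`F(L) < (2c/κ)·216 C² L R² · N`, while the heavy coins of scale `L'` (classes with `≥ a L'` points,
carrying a fixed fraction of all points) give `F(L) ≥ c₅ N · min(L', L²/R)` by the cell covering. [folklore] -/
theorem stub_coinScaleRatio
    (hSlab : ∀ (N : ℕ) (x : Fin N → E3), (∀ j k : Fin N, j ≠ k → (7 : ℝ) / 10 ≤ dist (x j) (x k)) →
      ∀ (R ρ : ℝ), 1 ≤ R → 1 ≤ ρ → ∀ (z : E3) (A : E3 →ₗᵢ[ℝ] E3) (S : Finset (Fin N)),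
        (∀ p ∈ S, |(A (x p - z)) 2| ≤ R ∧ dist (x p) z ≤ ρ) →
        (S.card : ℝ) ≤ 216 * ρ ^ 2 * R)
    (hCover : ∀ (N : ℕ) (x : Fin N → E3) (R ρ L : ℝ), 1 ≤ R → 0 < ρ → 4 * R ≤ L →
      ∀ (z : E3) (A : E3 →ₗᵢ[ℝ] E3) (S : Finset (Fin N)),
        (∀ p ∈ S, |(A (x p - z)) 2| ≤ R ∧ dist (x p) z ≤ ρ) →
        (S.card : ℝ) ^ 2 ≤ max 1 (64 * ρ ^ 2 / L ^ 2) *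
          (((S ×ˢ S).filter fun p : Fin N × Fin N => dist (x p.1) (x p.2) ≤ L).card : ℝ))
    (hPC : ∀ (N : ℕ) (x : Fin N → E3) (ρ : ℝ), 0 < ρ →
      (∀ S : Finset (Fin N), S.Nonempty → Sᶜ.Nonempty → ∃ p ∈ S, ∃ k ∈ Sᶜ, dist (x p) (x k) ≤ ρ) →
      ∀ (i : Fin N) (L : ℝ), 0 ≤ L → (∃ j : Fin N, L < dist (x j) (x i)) →
        L / ρ ≤ ((Finset.univ.filter fun j : Fin N => dist (x j) (x i) ≤ L).card : ℝ)) :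
    ∀ κ R c C L_I : ℝ, 0 < κ → 1 ≤ R → 0 < c → 1 ≤ C →
      (∀ L : ℝ, L_I ≤ L → ∀ (N : ℕ) (x : Fin N → E3),
        (∀ j k : Fin N, j ≠ k → (7 : ℝ) / 10 ≤ dist (x j) (x k)) →
        (∀ S : Finset (Fin N), S.Nonempty → Sᶜ.Nonempty →
            ∃ p ∈ S, ∃ k ∈ Sᶜ, dist (x p) (x k) ≤ 23 / 20) →
        ∃ lab : Fin N → ℕ,
          (∀ l : ℕ, ∃ (z : E3) (A : E3 →ₗᵢ[ℝ] E3), ∀ p : Fin N, lab p = l →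
              |(A (x p - z)) 2| ≤ R ∧ dist (x p) z ≤ C * Real.sqrt (L * R)) ∧
          ((Finset.univ.filter fun p : Fin N × Fin N =>
              L - R < dist (x p.1) (x p.2) ∧ dist (x p.1) (x p.2) ≤ L).card : ℝ) ≤
            c * ((Finset.univ.filter fun p : Fin N × Fin N => lab p.1 = lab p.2).card : ℝ) +
              κ / 2 * ((Finset.univ.filter fun p : Fin N × Fin N =>
                dist (x p.1) (x p.2) ≤ L).card : ℝ)) →
      ∃ C₆ L₁ : ℝ, 1 ≤ C₆ ∧ ∀ (N : ℕ) (x : Fin N → E3),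
        (∀ j k : Fin N, j ≠ k → (7 : ℝ) / 10 ≤ dist (x j) (x k)) →
        (∀ S : Finset (Fin N), S.Nonempty → Sᶜ.Nonempty →
            ∃ p ∈ S, ∃ k ∈ Sᶜ, dist (x p) (x k) ≤ 23 / 20) →
        ∀ L L' : ℝ, L₁ ≤ L → L ≤ L' →
          κ * ((Finset.univ.filter fun p : Fin N × Fin N => dist (x p.1) (x p.2) ≤ L).card : ℝ) <
            ((Finset.univ.filter fun p : Fin N × Fin N =>
                L - R < dist (x p.1) (x p.2) ∧ dist (x p.1) (x p.2) ≤ L).card : ℝ) →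
          κ * ((Finset.univ.filter fun p : Fin N × Fin N => dist (x p.1) (x p.2) ≤ L').card : ℝ) <
            ((Finset.univ.filter fun p : Fin N × Fin N =>
                L' - R < dist (x p.1) (x p.2) ∧ dist (x p.1) (x p.2) ≤ L').card : ℝ) →
          L' ≤ C₆ * L := by
  intro κ R c C L_I hκ hR hc hC hI
  classical
  -- constants: `A₁ = 2c·216C²R²/κ` (upper bound), `a₀ = 5κ/(46c)` (heavy fraction)
  obtain ⟨A₁, hA₁⟩ : ∃ A₁ : ℝ, A₁ = 2 * c * (216 * C ^ 2) * R ^ 2 / κ := ⟨_, rfl⟩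
  obtain ⟨a₀, ha₀⟩ : ∃ a₀ : ℝ, a₀ = 5 * κ / (46 * c) := ⟨_, rfl⟩
  have hA₁0 : 0 < A₁ := by rw [hA₁]; positivity
  have ha₀0 : 0 < a₀ := by rw [ha₀]; positivity
  have hA₁κ : κ * A₁ = 2 * c * (216 * C ^ 2) * R ^ 2 := by rw [hA₁]; field_simp
  have ha₀c : c * a₀ = 5 * κ / 46 := by rw [ha₀]; field_simp
  refine ⟨max 1 (4 * A₁ * (216 * C ^ 2) * R ^ 2 / a₀ ^ 2),
    max (max L_I (4 * R)) (max 1 (256 * A₁ * C ^ 2 * (216 * C ^ 2) * R ^ 3 / a₀ ^ 2 + 1)),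
    le_max_left _ _, ?_⟩
  intro N x hsep hconn L L' hL hLL' hspL hspL'
  have hLI : L_I ≤ L := le_trans (le_trans (le_max_left _ _) (le_max_left _ _)) hL
  have h4R : 4 * R ≤ L := le_trans (le_trans (le_max_right _ _) (le_max_left _ _)) hL
  have hL1 : 1 ≤ L := le_trans (le_trans (le_max_left _ _) (le_max_right _ _)) hL
  have hLA : 256 * A₁ * C ^ 2 * (216 * C ^ 2) * R ^ 3 / a₀ ^ 2 + 1 ≤ L :=
    le_trans (le_trans (le_max_right _ _) (le_max_right _ _)) hL
  obtain ⟨hLI', hL1'⟩ : L_I ≤ L' ∧ 1 ≤ L' := ⟨hLI.trans hLL', hL1.trans hLL'⟩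
  obtain ⟨hL0, hL0', hR0⟩ : 0 < L ∧ 0 < L' ∧ 0 ≤ R := ⟨by linarith, by linarith, by linarith⟩
  -- Step 1: the flat coins of scale `L` give `F(L) < A₁ L N`
  obtain ⟨lab, hflat, hcount⟩ := hI L hLI N x hsep hconn
  have hQ : ((Finset.univ.filter fun p : Fin N × Fin N => lab p.1 = lab p.2).card : ℝ) ≤
      N * (216 * C ^ 2 * L * R ^ 2) := by
    refine coinScaleRatio_samelabel_le lab fun l => ?_
    obtain ⟨z, A, hzA⟩ := hflat l
    exact coinScaleRatio_class_card_le hSlab x hsep hR hC hL1 z A _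
      fun p hp => hzA p (Finset.mem_filter.1 hp).2
  have hU : ((Finset.univ.filter fun p : Fin N × Fin N => dist (x p.1) (x p.2) ≤ L).card : ℝ) <
      A₁ * L * N := by
    have h1 := mul_le_mul_of_nonneg_left hQ hc.le
    refine lt_of_mul_lt_mul_left ?_ hκ.le
    have e : κ * (A₁ * L * N) = κ * A₁ * (L * N) := by ring
    rw [e, hA₁κ]
    linarith
  -- Step 2a: a pair in the `L'`-shell and the path count give `F(L') ≥ (5/23) L' N`,
  -- hence `Q' > a₀ L' N`
  obtain ⟨lab', hflat', hcount'⟩ := hI L' hLI' N x hsep hconn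
  have hSh0 : 0 < ((Finset.univ.filter fun p : Fin N × Fin N =>
      L' - R < dist (x p.1) (x p.2) ∧ dist (x p.1) (x p.2) ≤ L').card : ℝ) := by
    have h0 : (0 : ℝ) ≤ κ * ((Finset.univ.filter fun p : Fin N × Fin N =>
        dist (x p.1) (x p.2) ≤ L').card : ℝ) := mul_nonneg hκ.le (Nat.cast_nonneg _)
    linarith
  obtain ⟨pq, hpq⟩ := Finset.card_pos.1 (Nat.cast_pos.1 hSh0)
  have hpq' := (Finset.mem_filter.1 hpq).2
  have hlowF' := coinScaleRatio_pairs_lower hPC x hconn hR0 (by linarith) hpq'.1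
  have hQ' : a₀ * L' * N <
      ((Finset.univ.filter fun p : Fin N × Fin N => lab' p.1 = lab' p.2).card : ℝ) := by
    refine lt_of_mul_lt_mul_left ?_ hc.le
    have e : c * (a₀ * L' * N) = c * a₀ * (L' * N) := by ring
    rw [e, ha₀c]
    have h2 : κ / 2 * (5 / 23 * L' * N) ≤ κ / 2 * ((Finset.univ.filter fun p : Fin N × Fin N =>
        dist (x p.1) (x p.2) ≤ L').card : ℝ) := mul_le_mul_of_nonneg_left hlowF' (by positivity)
    linarith
  -- Step 2b/2c: heavy classes of scale `L'` and the cell covering bound `F(L)` from below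
  have hρ0 : 0 < C * Real.sqrt (L' * R) :=
    mul_pos (by linarith) (Real.sqrt_pos.2 (mul_pos hL0' (by linarith)))
  have hB0 : 0 < 216 * C ^ 2 * L' * R ^ 2 := by positivity
  have hm0 : 0 < max 1 (64 * (C * Real.sqrt (L' * R)) ^ 2 / L ^ 2) :=
    lt_of_lt_of_le one_pos (le_max_left _ _)
  have hQ'eq := coinScaleRatio_card_samelabel_eq lab'
  have hheavy : (a₀ * L' / 2) ^ 2 * N /
      (max 1 (64 * (C * Real.sqrt (L' * R)) ^ 2 / L ^ 2) * (216 * C ^ 2 * L' * R ^ 2)) <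
      ∑ l ∈ Finset.univ.image lab', ((((Finset.univ.filter fun p : Fin N => lab' p = l) ×ˢ
        (Finset.univ.filter fun p : Fin N => lab' p = l)).filter
          fun p : Fin N × Fin N => dist (x p.1) (x p.2) ≤ L).card : ℝ) := by
    refine coinScaleRatio_heavy_sum (Finset.univ.image lab')
      (fun l => ((Finset.univ.filter fun p : Fin N => lab' p = l).card : ℝ))
      (fun l => ((((Finset.univ.filter fun p : Fin N => lab' p = l) ×ˢ
        (Finset.univ.filter fun p : Fin N => lab' p = l)).filter
          fun p : Fin N × Fin N => dist (x p.1) (x p.2) ≤ L).card : ℝ))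
      (a := a₀ * L' / 2) (Ntot := (N : ℝ)) (by positivity) hB0 hm0
      (fun l _ => Nat.cast_nonneg _) (fun l _ => Nat.cast_nonneg _)
      (coinScaleRatio_sum_card_classes lab') ?_ ?_ ?_
    · rw [← hQ'eq]
      have e : 2 * (a₀ * L' / 2) * (N : ℝ) = a₀ * L' * N := by ring
      rw [e]
      exact hQ'
    · intro l _
      obtain ⟨z, A, hzA⟩ := hflat' l
      exact coinScaleRatio_class_card_le hSlab x hsep hR hC hL1' z A _
        fun p hp => hzA p (Finset.mem_filter.1 hp).2
    · intro l _ _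
      obtain ⟨z, A, hzA⟩ := hflat' l
      exact hCover N x R (C * Real.sqrt (L' * R)) L hR hρ0 h4R z A _
        fun p hp => hzA p (Finset.mem_filter.1 hp).2
  have hTF := coinScaleRatio_sum_card_classpairs_le x lab' (Finset.univ.image lab') L
  -- Step 3: combine the two bounds and divide by `N > 0`
  have hF0 : (0 : ℝ) ≤ ((Finset.univ.filter fun p : Fin N × Fin N =>
      dist (x p.1) (x p.2) ≤ L).card : ℝ) := Nat.cast_nonneg _
  have hN0 : (0 : ℝ) < N := by
    by_contra hN
    push Not at hN
    have hN' : (N : ℝ) = 0 := le_antisymm hN (Nat.cast_nonneg N)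
    rw [hN', mul_zero] at hU
    linarith
  have hchain : (a₀ * L' / 2) ^ 2 * N /
      (max 1 (64 * (C * Real.sqrt (L' * R)) ^ 2 / L ^ 2) * (216 * C ^ 2 * L' * R ^ 2)) <
      A₁ * L * N := by linarith
  rw [div_lt_iff₀ (mul_pos hm0 hB0)] at hchain
  have hstar : (a₀ * L' / 2) ^ 2 <
      A₁ * L * (max 1 (64 * (C * Real.sqrt (L' * R)) ^ 2 / L ^ 2) * (216 * C ^ 2 * L' * R ^ 2)) := by
    refine lt_of_mul_lt_mul_right ?_ hN0.le
    linarith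
  have hfin := coinScaleRatio_final ha₀0 hR hL0 hL0' hstar hLA
  exact le_trans hfin (mul_le_mul_of_nonneg_right (le_max_right _ _) hL0.le)

end Summit.AtomisticToContinuum.Crystallization.Theorems.LjLaminarWindowsSketch

end
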